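import Summits.HubbardSuperconductivity.HubbardSuperconductivity.Theses.IsoperimetricCascade
import Summits.HubbardSuperconductivity.HubbardSuperconductivity.Theorems.IsoperimetricCascadeFlatAGPNormGrowth
import Literature.MathematicalPhysics.QuantumLattice.PairFieldPairedVectors

/-!
# F3 special-case file for the forward rung `SpectatorStableNormGrowth` (crux `OverlapRate`, stmt-HubbardSuperconductivity-11981)

The rung is the graded family `SpectatorNormGrowth m` (`m` = spectator particle number of the reference
vector), rung = `∀ m`. This self-contained file re-states the family VERBATIM (namespace `.Special`, so it
elaborates without importing the line file `Lines/SpectatorStableNormGrowth.lean`, which is not a built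
module) and proves the literal instance `m = 0` from the FLOOR

  `Summit.HubbardSuperconductivity.HubbardSuperconductivity.Theorems.IsoperimetricCascade.flatAGPNormGrowth_proof :
     Summit.HubbardSuperconductivity.HubbardSuperconductivity.Theses.IsoperimetricCascade.FlatAGPNormGrowth`

(item stmt-HubbardSuperconductivity-11982, proved): a `0`-particle vector is `χ ∅ • |0⟩`, so the two sides
scale by `|χ ∅|²`. The same theorem, over the line file's own decl, is
`…Cruxes.OverlapRate.SpectatorStableNormGrowth.SpectatorNormGrowth_zero` in `Lines/SpectatorStableNormGrowth.lean`.
No `sorry`.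
-/

set_option linter.dupNamespace false

noncomputable section

open scoped BigOperators Topology Classical Matrix ComplexConjugate Matrix.Norms.L2Operator
open Matrix Literature.Probability.LatticeModels Literature.MathematicalPhysics.QuantumLattice

namespace Summit.HubbardSuperconductivity.HubbardSuperconductivity.Cruxes.OverlapRate.SpectatorStableNormGrowth.Special

def SpectatorNormGrowth (m : ℕ) : Prop :=
  ∀ δ ∈ Set.Ioo (0:ℝ) 1, ∀ r : ℕ, ∃ κ : ℝ, 0 < κ ∧ ∃ L₀ : ℕ, ∀ (L : ℕ) [NeZero L], L₀ ≤ L →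
    ∀ χ : Fock (Orb (FermionTorus 2 L)), IsNParticle m χ →
      let n := ⌊(1 - δ) * (L : ℝ) ^ 2 / 2⌋₊ - r
      let Φ := (pairField dWaveFormFactor L)ᴴ ^ n *ᵥ χ
      (κ * (L : ℝ) ^ 4) ^ n * (star χ ⬝ᵥ χ).re ≤ (star Φ ⬝ᵥ Φ).re

/-- **F3 witness**: the floor is the `m = 0` member of the family. -/
theorem rung_special : SpectatorNormGrowth 0 := by
  intro δ hδ r
  obtain ⟨κ, hκ, L₀, h⟩ :=
    Summit.HubbardSuperconductivity.HubbardSuperconductivity.Theorems.IsoperimetricCascade.flatAGPNormGrowth_proof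
      δ hδ r
  refine ⟨κ, hκ, L₀, ?_⟩
  intro L _ hL χ hχ
  have hfloor := h L hL
  simp only at hfloor ⊢
  have hχeq : χ = χ ∅ • (vacuum : Fock (Orb (FermionTorus 2 L))) := by
    funext s
    by_cases hs : s = ∅
    · subst hs; simp [vacuum]
    · have h0 : χ s = 0 := hχ s (fun h => hs (Finset.card_eq_zero.1 h))
      simp [vacuum, hs, h0]
  set a : ℂ := χ ∅ with ha
  set n : ℕ := ⌊(1 - δ) * (L : ℝ) ^ 2 / 2⌋₊ - r with hn
  set Φ₀ := (pairField dWaveFormFactor L)ᴴ ^ n *ᵥ (vacuum : Fock (Orb (FermionTorus 2 L))) with hΦ₀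
  have hΦ : (pairField dWaveFormFactor L)ᴴ ^ n *ᵥ χ = a • Φ₀ := by
    rw [hχeq, mulVec_smul]
  have hnormχ : (star χ ⬝ᵥ χ).re = ‖a‖ ^ 2 := by
    rw [hχeq, star_smul, smul_dotProduct, dotProduct_smul, star_vacuum_dotProduct_vacuum]
    simp only [smul_eq_mul, mul_one, Complex.star_def]
    rw [Complex.conj_mul', ← Complex.ofReal_pow, Complex.ofReal_re]
  have hnormΦ : (star (a • Φ₀) ⬝ᵥ (a • Φ₀)).re = ‖a‖ ^ 2 * (star Φ₀ ⬝ᵥ Φ₀).re := by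
    rw [star_smul, smul_dotProduct, dotProduct_smul, smul_smul]
    simp only [smul_eq_mul, Complex.star_def]
    rw [Complex.conj_mul', ← Complex.ofReal_pow, Complex.re_ofReal_mul]
  rw [hΦ, hnormχ, hnormΦ, mul_comm]
  exact mul_le_mul_of_nonneg_left hfloor (sq_nonneg _)

/-- F3 shape: `example : <Rung family> <special args> := <witness-derived>`. -/
example : SpectatorNormGrowth 0 := rung_special

end Summit.HubbardSuperconductivity.HubbardSuperconductivity.Cruxes.OverlapRate.SpectatorStableNormGrowth.Special
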